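import Summits.AnomalousDissipation.AnomalousDissipation.Theorems.MarginalStabilityChainStrainedLayerLawClockEnergyRelaminarisationToolsB
import HarnessLib

/-!
# Crux `MarginalStabilityChain.StrainedLayerLaw` (stmt-AnomalousDissipation-3007), line `FirstLemmasR2K4`
# (log-enstrophy clock + Nash roundness): energy relaminarisation of the tailed class — tools C

Support file (`--supports stmt-AnomalousDissipation-3007`; registered sub-goal `energyRelam_continuousOn_gradient`, the
third tool file of the registered sub-goal `energy_relaminarisation` of line `FirstLemmasR2K4`, lead c7), everything
proved. With `U_B = burgersLayerProfile 1 ν 1`, `a = u − U_B`, `b = v`, `W = ∫∫(a² + b²)`, `I = ∫∫(a∂ₜu + b∂ₜv)`,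
`G = ∫∫((∂ₓu)² + (∂_yu − U_B′)² + (∂ₓv)² + (∂_yv)²)` over the period strip `(0, L] × ℝ`:

* `energyRelam_wirtinger_strip`: WIRTINGER ON THE STRIP for the transverse velocity of a tailed divergence-free slice —
  `v` has zero mean on every line `y = const` (`∂_y∫₀ᴸ v = −∫₀ᴸ ∂ₓu = 0`, `∫₀ᴸ v → 0`), hence
  `∫∫ v² ≤ (L/2π)² ∫∫ (∂ₓv)²` (`stub_excessEnergyKinematic_wirtinger` line by line, Fubini);
* `energyRelam_estimate`: THE TWO ENERGY INEQUALITIES at a fixed time under `L²(3πν + 2) ≤ 16π³ν²`: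
  `2I ≤ −½W` and `2νG ≤ −2I + (1 + 1/(πν))W` — from the exact identity `I = −∫∫abU_B′ − ½W + ∫∫b² − νG`
  (`energyRelam_identity`, tool file B), `−abU_B′ ≤ ¼a² + U_B′²b²`, `U_B′² ≤ 1/(2πν)`, Wirtinger, and the hypothesis
  in the form `(¾ + 1/(2πν))(L/2π)² ≤ ν`;
* `energyRelam_hasDerivAt`: `W` is differentiable in time with `W′ = 2I` (differentiation under the integral sign);
* `energyRelam_continuousOn_gradient` (registered): `G` is continuous in time on tailed windows (dominated
  convergence).

References: J. Serrin, Arch. Rational Mech. Anal. 3 (1959) 1–13; D. D. Joseph, *Stability of Fluid Motions I*,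
Springer 1976, §2–§4 (energy method); A. J. Majda, A. L. Bertozzi, *Vorticity and Incompressible Flow*, CUP 2002,
§3.1.1; G. H. Hardy, J. E. Littlewood, G. Pólya, *Inequalities*, CUP 1952, §7.7 (Wirtinger).
-/

-- `Summit.<Summit>.<Problem>` is the tree's mandated summit-side namespace (CONVENTIONS §2); for this
-- single-conjunct summit the two coincide, so the duplicate is deliberate.
set_option linter.dupNamespace false

noncomputable section

open scoped Topology ENNReal
open Filter Set Function MeasureTheory

namespace Summit.AnomalousDissipation.AnomalousDissipation.Theorems.StrainedLayerLaw.LogEnstrophyClock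

open Literature.Analysis.FluidPDE Literature.Analysis.FluidPDE.StretchedLayer
open Summit.AnomalousDissipation.AnomalousDissipation.Theses.MarginalStabilityChain
open Summit.AnomalousDissipation.AnomalousDissipation.Theorems.StrainedLayerLaw.StrainWorkSumRule


/-! ## Fubini bridges on the period strip -/

/-- For a function integrable on the strip, the strip integral is `∫_y ∫₀ᴸ dx` (Fubini). [folklore] -/
theorem energyRelam_strip_eq_integral_intervalIntegral {L : ℝ} (hL : 0 ≤ L) {F : ℝ × ℝ → ℝ}
    (hF : IntegrableOn F (Ioc 0 L ×ˢ univ)) :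
    ∫ q in Ioc 0 L ×ˢ univ, F q = ∫ y, ∫ x in (0:ℝ)..L, F (x, y) := by
  rw [IntegrableOn, volume_restrict_strip] at hF
  rw [volume_restrict_strip, integral_prod_symm _ hF]
  exact integral_congr_ae (Eventually.of_forall fun y => (intervalIntegral.integral_of_le hL).symm)

/-- For a function integrable on the strip, `y ↦ ∫₀ᴸ F(x, y) dx` is integrable on `ℝ`. [folklore] -/
theorem energyRelam_integrable_intervalIntegral {L : ℝ} (hL : 0 ≤ L) {F : ℝ × ℝ → ℝ}
    (hF : IntegrableOn F (Ioc 0 L ×ˢ univ)) : Integrable fun y => ∫ x in (0:ℝ)..L, F (x, y) := by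
  rw [IntegrableOn, volume_restrict_strip] at hF
  exact hF.integral_prod_right.congr
    (Eventually.of_forall fun y => (intervalIntegral.integral_of_le hL).symm)

/-! ## Wirtinger on the period strip for the transverse velocity -/

/-- **Wirtinger on the strip.** For a `C²` divergence-free `L`-periodic slice `(f, g)` (`L > 0`) with shear tails
`SliceTails C k f g` (`k > 0`): `g²` and `(∂ₓg)²` are integrable on the period strip and
`∫∫ g² ≤ (L/2π)² ∫∫ (∂ₓg)²`. The period mean `∫₀ᴸ g(x, y) dx` vanishes for every `y` (its `y`-derivative is
`∫₀ᴸ ∂_yg = −∫₀ᴸ ∂ₓf = 0` and it tends to `0` as `y → ∞`), so Wirtinger's inequality applies on every line; integrate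
across the layer. [folklore] -/
theorem energyRelam_wirtinger_strip {L C k : ℝ} {f g : ℝ → ℝ → ℝ} (hL : 0 < L) (hk : 0 < k)
    (hf : ContDiff ℝ 2 (fun q : ℝ × ℝ => f q.1 q.2)) (hg : ContDiff ℝ 2 (fun q : ℝ × ℝ => g q.1 q.2))
    (hdiv : ∀ x y, dX f x y + dY g x y = 0) (hpf : ∀ x y, f (x + L) y = f x y)
    (hpg : ∀ x y, g (x + L) y = g x y) (hT : SliceTails C k f g) :
    IntegrableOn (fun q : ℝ × ℝ => g q.1 q.2 ^ 2) (Ioc 0 L ×ˢ univ) ∧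
    IntegrableOn (fun q : ℝ × ℝ => dX g q.1 q.2 ^ 2) (Ioc 0 L ×ˢ univ) ∧
    ∫ q in Ioc 0 L ×ˢ univ, g q.1 q.2 ^ 2 ≤
      (L / (2 * Real.pi)) ^ 2 * ∫ q in Ioc 0 L ×ˢ univ, dX g q.1 q.2 ^ 2 := by
  have hC : 0 ≤ C := hT.nonneg
  have hf1 : ContDiff ℝ 1 (fun q : ℝ × ℝ => f q.1 q.2) := hf.of_le one_le_two
  have hg1 : ContDiff ℝ 1 (fun q : ℝ × ℝ => g q.1 q.2) := hg.of_le one_le_two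
  have cg : Continuous (fun q : ℝ × ℝ => g q.1 q.2) := hg.continuous
  have cgx := continuous_dX hg1
  have dgx : ∀ x y, HasDerivAt (fun s => g s y) (dX g x y) x := hasDerivAt_dX_of_contDiff hg two_ne_zero
  -- integrability on the strip
  have ig2 : IntegrableOn (fun q : ℝ × ℝ => g q.1 q.2 ^ 2) (Ioc 0 L ×ˢ univ) :=
    integrableOn_strip_of_abs_le_exp (cg.pow 2) (by positivity : 0 ≤ C ^ 2) hk fun x _ y => by
      rw [abs_of_nonneg (sq_nonneg _)]; exact hT.sq_v_le hk x y
  have igx2 : IntegrableOn (fun q : ℝ × ℝ => dX g q.1 q.2 ^ 2) (Ioc 0 L ×ˢ univ) :=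
    integrableOn_strip_of_abs_le_exp (cgx.pow 2) (by positivity : 0 ≤ C ^ 2) hk fun x _ y => by
      have h := hT.abs_gradSq_le hk x y
      rw [abs_of_nonneg (by positivity)] at h
      rw [abs_of_nonneg (sq_nonneg _)]
      nlinarith [sq_nonneg (dX f x y), sq_nonneg (dY f x y), sq_nonneg (dY g x y)]
  -- zero period mean of `g` on every line
  have hxf : ∀ y, ∫ x in (0:ℝ)..L, dX f x y = 0 := intervalIntegral_dX_period_eq_zero hf1 hpf
  have hV0 : ∀ y, ∫ x in (0:ℝ)..L, g x y = 0 := by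
    have hV' : ∀ y, HasDerivAt (fun t => ∫ x in (0:ℝ)..L, g x t) 0 y := by
      intro y
      refine (hasDerivAt_intervalIntegral_dY hg1 0 L y).congr_deriv ?_
      have e : ∀ x, dY g x y = -dX f x y := fun x => by linarith [hdiv x y]
      simp_rw [e]
      rw [intervalIntegral.integral_neg, hxf y, neg_zero]
    have hconst : ∀ y y', (∫ x in (0:ℝ)..L, g x y) = ∫ x in (0:ℝ)..L, g x y' :=
      is_const_of_deriv_eq_zero (fun y => (hV' y).differentiableAt) fun y => (hV' y).deriv
    have hbdV : ∀ y, |∫ x in (0:ℝ)..L, g x y| ≤ L * C * Real.exp (-k * |y|) := by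
      intro y
      have h := intervalIntegral.norm_integral_le_of_norm_le_const (a := 0) (b := L) (f := fun x => g x y)
        (C := C * Real.exp (-k * |y|)) fun x _ => by rw [Real.norm_eq_abs]; exact hT.abs_v_le x y
      rw [Real.norm_eq_abs, sub_zero, abs_of_pos hL] at h
      linarith
    have hlim : Tendsto (fun y => ∫ x in (0:ℝ)..L, g x y) atTop (𝓝 0) :=
      tendsto_zero_atTop_of_abs_le_exp hk hbdV
    intro y
    exact tendsto_nhds_unique tendsto_const_nhds (hlim.congr fun y' => hconst y' y)
  -- Wirtinger on every line, then across the layer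
  have hrow : ∀ y, ∫ x in (0:ℝ)..L, g x y ^ 2 ≤ (L / (2 * Real.pi)) ^ 2 * ∫ x in (0:ℝ)..L, dX g x y ^ 2 :=
    fun y => stub_excessEnergyKinematic_wirtinger L (fun x => g x y) (fun x => dX g x y) hL
      (fun x => dgx x y) (continuous_slice_x cgx y) (by simpa using hpg 0 y) (hV0 y)
  refine ⟨ig2, igx2, ?_⟩
  rw [energyRelam_strip_eq_integral_intervalIntegral hL.le ig2,
    energyRelam_strip_eq_integral_intervalIntegral hL.le igx2, ← integral_const_mul]
  exact integral_mono (energyRelam_integrable_intervalIntegral hL.le ig2)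
    ((energyRelam_integrable_intervalIntegral hL.le igx2).const_mul _) hrow

/-! ## The energy inequality at a fixed time -/

/-- **The two energy inequalities at a fixed time.** Under the hypotheses of `energyRelam_identity` and
`L²(3πν + 2) ≤ 16π³ν²` (equivalently `4π²ν/L² ≥ ¾ + 1/(2πν)`), with `W = ∫∫((u − U_B)² + v²)`,
`I = ∫∫((u − U_B)∂ₜu + v∂ₜv)` (`= ½W′`) and `G = ∫∫((∂ₓu)² + (∂_yu − U_B′)² + (∂ₓv)² + (∂_yv)²)`:
`2I ≤ −½W` and `2νG ≤ −2I + (1 + 1/(πν))W`. From the identity `I = −∫∫abU_B′ − ½W + ∫∫b² − νG`: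
`−abU_B′ ≤ ¼(a² + b²) + (1/(2πν) − ¼)b²` pointwise (`(½a + U_B′b)² ≥ 0`, `U_B′² ≤ 1/(2πν)`), Wirtinger on the strip
`∫∫b² ≤ (L/2π)²∫∫(∂ₓb)² ≤ (L/2π)²G`, hence `(¾ + 1/(2πν))∫∫b² ≤ νG`. [folklore] -/
theorem energyRelam_estimate {ν L t C k : ℝ} {u v p : ℝ → ℝ → ℝ → ℝ} (hν : 0 < ν) (hL : 0 < L) (ht : 0 < t)
    (hk : 0 < k) (hνL : L ^ 2 * (3 * Real.pi * ν + 2) ≤ 16 * Real.pi ^ 3 * ν ^ 2)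
    (h : IsStretchedLayerNSSolutionOn (Ioi 0) ν 1 1 L u v p) (hST : SliceTails C k (u t) (v t))
    (hT : ∀ x y, |deriv (fun s => u s x y) t| + |deriv (fun s => v s x y) t| ≤ C * Real.exp (-k * |y|)) :
    2 * (∫ q in Ioc 0 L ×ˢ univ, ((u t q.1 q.2 - burgersLayerProfile 1 ν 1 q.2) * deriv (fun s => u s q.1 q.2) t +
        v t q.1 q.2 * deriv (fun s => v s q.1 q.2) t)) ≤
      -(1 / 2) * ∫ q in Ioc 0 L ×ˢ univ, ((u t q.1 q.2 - burgersLayerProfile 1 ν 1 q.2) ^ 2 + v t q.1 q.2 ^ 2) ∧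
    2 * (ν * ∫ q in Ioc 0 L ×ˢ univ, (dX (u t) q.1 q.2 ^ 2 + (dY (u t) q.1 q.2 - burgersLayerProfileD 1 ν 1 q.2) ^ 2 +
        dX (v t) q.1 q.2 ^ 2 + dY (v t) q.1 q.2 ^ 2)) ≤
      -(2 * ∫ q in Ioc 0 L ×ˢ univ, ((u t q.1 q.2 - burgersLayerProfile 1 ν 1 q.2) * deriv (fun s => u s q.1 q.2) t +
          v t q.1 q.2 * deriv (fun s => v s q.1 q.2) t)) +
        (1 + 1 / (Real.pi * ν)) *
          ∫ q in Ioc 0 L ×ˢ univ, ((u t q.1 q.2 - burgersLayerProfile 1 ν 1 q.2) ^ 2 + v t q.1 q.2 ^ 2) := by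
  have ht' : t ∈ Ioi (0:ℝ) := ht
  obtain ⟨iE, ibb, ibx, iS, iG, -, hI⟩ := energyRelam_identity ν L t C k u v p hν hL ht hk h hST hT
  obtain ⟨-, -, -, hDsq, -, -⟩ := energyRelam_profile hν
  obtain ⟨-, -, hWirt⟩ := energyRelam_wirtinger_strip hL hk (h.contDiff_u ht') (h.contDiff_v ht') (h.divFree t ht')
    (h.periodic_u t ht') (h.periodic_v t ht') hST
  set UB := burgersLayerProfile 1 ν 1 with hUB_def
  set UB' := burgersLayerProfileD 1 ν 1 with hUB'_def
  set I : ℝ := ∫ q in Ioc 0 L ×ˢ univ, ((u t q.1 q.2 - UB q.2) * deriv (fun s => u s q.1 q.2) t +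
    v t q.1 q.2 * deriv (fun s => v s q.1 q.2) t) with hI_def
  set W : ℝ := ∫ q in Ioc 0 L ×ˢ univ, ((u t q.1 q.2 - UB q.2) ^ 2 + v t q.1 q.2 ^ 2) with hW_def
  set S : ℝ := ∫ q in Ioc 0 L ×ˢ univ, (u t q.1 q.2 - UB q.2) * v t q.1 q.2 * UB' q.2 with hS_def
  set B : ℝ := ∫ q in Ioc 0 L ×ˢ univ, v t q.1 q.2 ^ 2 with hB_def
  set Bx : ℝ := ∫ q in Ioc 0 L ×ˢ univ, dX (v t) q.1 q.2 ^ 2 with hBx_def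
  set G : ℝ := ∫ q in Ioc 0 L ×ˢ univ, (dX (u t) q.1 q.2 ^ 2 + (dY (u t) q.1 q.2 - UB' q.2) ^ 2 +
    dX (v t) q.1 q.2 ^ 2 + dY (v t) q.1 q.2 ^ 2) with hG_def
  set c : ℝ := 1 / (2 * Real.pi * ν) with hc_def
  have hc0 : 0 ≤ c := by positivity
  have hS : MeasurableSet (Ioc (0:ℝ) L ×ˢ (univ : Set ℝ)) := measurableSet_Ioc.prod MeasurableSet.univ
  -- the strain term by Cauchy–Schwarz / AM–GM, pointwise
  have hAM : -S ≤ (1 / 4) * W + (c - 1 / 4) * B := by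
    have h1 : ∫ q in Ioc 0 L ×ˢ univ, -((u t q.1 q.2 - UB q.2) * v t q.1 q.2 * UB' q.2) ≤
        ∫ q in Ioc 0 L ×ˢ univ, ((1 / 4) * ((u t q.1 q.2 - UB q.2) ^ 2 + v t q.1 q.2 ^ 2) +
          (c - 1 / 4) * v t q.1 q.2 ^ 2) := by
      refine integral_mono iS.neg ((iE.const_mul _).add (ibb.const_mul _)) fun q => ?_
      have h2 := mul_le_mul_of_nonneg_right (hDsq q.2) (sq_nonneg (v t q.1 q.2))
      simp only
      nlinarith [sq_nonneg ((u t q.1 q.2 - UB q.2) / 2 + UB' q.2 * v t q.1 q.2)]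
    rw [MeasureTheory.integral_neg, integral_add (iE.const_mul _) (ibb.const_mul _),
      MeasureTheory.integral_const_mul, MeasureTheory.integral_const_mul] at h1
    exact h1
  -- `∫∫b² ≤ W`, `∫∫(∂ₓb)² ≤ G`, Wirtinger, and the hypothesis on `L`
  have hBW : B ≤ W := integral_mono ibb iE fun q => by
    simp only; nlinarith [sq_nonneg (u t q.1 q.2 - UB q.2)]
  have hBxG : Bx ≤ G := integral_mono ibx iG fun q => by
    simp only
    nlinarith [sq_nonneg (dX (u t) q.1 q.2), sq_nonneg (dY (u t) q.1 q.2 - UB' q.2), sq_nonneg (dY (v t) q.1 q.2)]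
  have hG0 : 0 ≤ G := setIntegral_nonneg hS fun q _ => by positivity
  have hcoef : (3 / 4 + c) * (L / (2 * Real.pi)) ^ 2 ≤ ν := by
    have hπ := Real.pi_pos
    have e : (3 / 4 + c) * (L / (2 * Real.pi)) ^ 2 = L ^ 2 * (3 * Real.pi * ν + 2) / (16 * Real.pi ^ 3 * ν) := by
      rw [hc_def]
      field_simp
      ring
    rw [e, div_le_iff₀ (by positivity)]
    nlinarith
  have hkey : (3 / 4 + c) * B ≤ ν * G := by
    have h1 : B ≤ (L / (2 * Real.pi)) ^ 2 * G := hWirt.trans (mul_le_mul_of_nonneg_left hBxG (sq_nonneg _))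
    calc (3 / 4 + c) * B ≤ (3 / 4 + c) * ((L / (2 * Real.pi)) ^ 2 * G) :=
          mul_le_mul_of_nonneg_left h1 (by positivity)
      _ = (3 / 4 + c) * (L / (2 * Real.pi)) ^ 2 * G := by ring
      _ ≤ ν * G := mul_le_mul_of_nonneg_right hcoef hG0
  -- conclude from the identity
  have hc2 : 2 * c = 1 / (Real.pi * ν) := by rw [hc_def]; field_simp
  have h3 := mul_le_mul_of_nonneg_left hBW (by positivity : 0 ≤ 3 / 2 + 2 * c)
  have hIeq : I = -S - (1 / 2) * W + B - ν * G := hI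
  refine ⟨by linarith, ?_⟩
  rw [← hc2]
  linarith

/-! ## Time regularity of the perturbation energy and of the gradient budget -/

/-- **The perturbation energy is differentiable in time.** For velocity fields of a classical solution with uniform
shear tails on `[a′, b′] ⊂ (0, ∞)`, the strip energy `W(σ) = ∫∫((u − U_B)² + v²)` has derivative
`2∫∫((u − U_B)∂ₜu + v∂ₜv)` at every `s ∈ (a′, b′)` (differentiation under the integral sign,
`hasDerivAt_integral_of_dominated_loc_of_deriv_le`, domination `2((3/2 + C)C + C²)e^{−k|y|}`; integrability of
`W`'s integrand from `energyRelam_identity`). [folklore] -/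
theorem energyRelam_hasDerivAt {ν L a' b' C k : ℝ} {u v p : ℝ → ℝ → ℝ → ℝ} (hν : 0 < ν) (hL : 0 < L)
    (ha : 0 < a') (hk : 0 < k) (h : IsStretchedLayerNSSolutionOn (Ioi 0) ν 1 1 L u v p)
    (hST : ∀ s ∈ Icc a' b', SliceTails C k (u s) (v s))
    (hTd : ∀ s ∈ Icc a' b', ∀ x y, |deriv (fun r => u r x y) s| + |deriv (fun r => v r x y) s| ≤
      C * Real.exp (-k * |y|)) {s : ℝ} (hs : s ∈ Ioo a' b') :
    HasDerivAt (fun σ => ∫ q in Ioc 0 L ×ˢ univ, ((u σ q.1 q.2 - burgersLayerProfile 1 ν 1 q.2) ^ 2 + v σ q.1 q.2 ^ 2))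
      (2 * ∫ q in Ioc 0 L ×ˢ univ, ((u s q.1 q.2 - burgersLayerProfile 1 ν 1 q.2) * deriv (fun r => u r q.1 q.2) s +
        v s q.1 q.2 * deriv (fun r => v r q.1 q.2) s)) s := by
  have hpos : ∀ {σ : ℝ}, σ ∈ Icc a' b' → 0 < σ := fun hσ => ha.trans_le hσ.1
  have hsab : s ∈ Icc a' b' := Ioo_subset_Icc_self hs
  have hs0 : 0 < s := hpos hsab
  have hC : 0 ≤ C := (hST s hsab).nonneg
  have hN : Ioo a' b' ∈ 𝓝 s := Ioo_mem_nhds hs.1 hs.2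
  obtain ⟨-, hUBle, -⟩ := energyRelam_profile hν
  set UB := burgersLayerProfile 1 ν 1 with hUB_def
  have cUB : Continuous (fun q : ℝ × ℝ => UB q.2) :=
    (contDiff_two_burgersLayerProfile 1 ν 1).continuous.comp continuous_snd
  -- slice regularity
  have cu : ∀ {σ : ℝ}, 0 < σ → Continuous (fun q : ℝ × ℝ => u σ q.1 q.2) := fun hσ =>
    (h.contDiff_u (mem_Ioi.2 hσ)).continuous
  have cv : ∀ {σ : ℝ}, 0 < σ → Continuous (fun q : ℝ × ℝ => v σ q.1 q.2) := fun hσ =>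
    (h.contDiff_v (mem_Ioi.2 hσ)).continuous
  have cut : Continuous (fun q : ℝ × ℝ => deriv (fun r => u r q.1 q.2) s) :=
    continuous_deriv_time isOpen_Ioi h.contDiffOn_u (mem_Ioi.2 hs0)
  have cvt : Continuous (fun q : ℝ × ℝ => deriv (fun r => v r q.1 q.2) s) :=
    continuous_deriv_time isOpen_Ioi h.contDiffOn_v (mem_Ioi.2 hs0)
  -- atomic bounds on `[a', b']`
  have bu : ∀ σ ∈ Icc a' b', ∀ x y, |u σ x y - UB y| ≤ 3 / 2 + C := fun σ hσ x y =>
    (abs_sub _ _).trans (by linarith [(hST σ hσ).abs_u_le hk x y, hUBle y])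
  have bv : ∀ σ ∈ Icc a' b', ∀ x y, |v σ x y| ≤ C := fun σ hσ => (hST σ hσ).abs_v_le_const hk
  have but : ∀ σ ∈ Icc a' b', ∀ x y, |deriv (fun r => u r x y) σ| ≤ C * Real.exp (-k * |y|) :=
    fun σ hσ x y => by linarith [hTd σ hσ x y, abs_nonneg (deriv (fun r => v r x y) σ)]
  have bvt : ∀ σ ∈ Icc a' b', ∀ x y, |deriv (fun r => v r x y) σ| ≤ C * Real.exp (-k * |y|) :=
    fun σ hσ x y => by linarith [hTd σ hσ x y, abs_nonneg (deriv (fun r => u r x y) σ)]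
  -- the dominated differentiation
  have hFmeas : ∀ᶠ σ in 𝓝 s, AEStronglyMeasurable
      (fun q : ℝ × ℝ => (u σ q.1 q.2 - UB q.2) ^ 2 + v σ q.1 q.2 ^ 2) (volume.restrict (Ioc 0 L ×ˢ univ)) := by
    filter_upwards [hN] with σ hσ
    have hσ0 := hpos (Ioo_subset_Icc_self hσ)
    exact ((((cu hσ0).sub cUB).pow 2).add ((cv hσ0).pow 2)).aestronglyMeasurable
  have hFint : IntegrableOn (fun q : ℝ × ℝ => (u s q.1 q.2 - UB q.2) ^ 2 + v s q.1 q.2 ^ 2) (Ioc 0 L ×ˢ univ) :=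
    (energyRelam_identity ν L s C k u v p hν hL hs0 hk h (hST s hsab) (hTd s hsab)).1
  have hF'meas : AEStronglyMeasurable (fun q : ℝ × ℝ => 2 * ((u s q.1 q.2 - UB q.2) * deriv (fun r => u r q.1 q.2) s +
      v s q.1 q.2 * deriv (fun r => v r q.1 q.2) s)) (volume.restrict (Ioc 0 L ×ˢ univ)) :=
    (continuous_const.mul ((((cu hs0).sub cUB).mul cut).add ((cv hs0).mul cvt))).aestronglyMeasurable
  have hF'le : ∀ q : ℝ × ℝ, ∀ σ ∈ Ioo a' b',
      ‖2 * ((u σ q.1 q.2 - UB q.2) * deriv (fun r => u r q.1 q.2) σ + v σ q.1 q.2 * deriv (fun r => v r q.1 q.2) σ)‖ ≤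
        2 * ((3 / 2 + C) * C + C * C) * Real.exp (-k * |q.2|) := by
    intro q σ hσ
    have hσ' := Ioo_subset_Icc_self hσ
    rw [Real.norm_eq_abs, abs_mul, abs_two]
    have i1 : |(u σ q.1 q.2 - UB q.2) * deriv (fun r => u r q.1 q.2) σ| ≤
        (3 / 2 + C) * (C * Real.exp (-k * |q.2|)) := by
      rw [abs_mul]
      exact mul_le_mul (bu σ hσ' q.1 q.2) (but σ hσ' q.1 q.2) (abs_nonneg _) (by linarith)
    have i2 : |v σ q.1 q.2 * deriv (fun r => v r q.1 q.2) σ| ≤ C * (C * Real.exp (-k * |q.2|)) := by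
      rw [abs_mul]
      exact mul_le_mul (bv σ hσ' q.1 q.2) (bvt σ hσ' q.1 q.2) (abs_nonneg _) hC
    have i3 := abs_add_le ((u σ q.1 q.2 - UB q.2) * deriv (fun r => u r q.1 q.2) σ)
      (v σ q.1 q.2 * deriv (fun r => v r q.1 q.2) σ)
    nlinarith
  have hwI : IntegrableOn (fun q : ℝ × ℝ => 2 * ((3 / 2 + C) * C + C * C) * Real.exp (-k * |q.2|))
      (Ioc 0 L ×ˢ univ) :=
    integrableOn_strip_of_abs_le_exp (continuous_const.mul
      (Real.continuous_exp.comp (continuous_const.mul (continuous_abs.comp continuous_snd))))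
      (by positivity : 0 ≤ 2 * ((3 / 2 + C) * C + C * C)) hk fun x _ y => by rw [abs_of_nonneg (by positivity)]
  have hdiff : ∀ q : ℝ × ℝ, ∀ σ ∈ Ioo a' b',
      HasDerivAt (fun σ => (u σ q.1 q.2 - UB q.2) ^ 2 + v σ q.1 q.2 ^ 2)
        (2 * ((u σ q.1 q.2 - UB q.2) * deriv (fun r => u r q.1 q.2) σ +
          v σ q.1 q.2 * deriv (fun r => v r q.1 q.2) σ)) σ := by
    intro q σ hσ
    have hσ0 := hpos (Ioo_subset_Icc_self hσ)
    have h1 := hasDerivAt_time_of_contDiffOn_Ioi h.contDiffOn_u hσ0 q.1 q.2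
    have h2 := hasDerivAt_time_of_contDiffOn_Ioi h.contDiffOn_v hσ0 q.1 q.2
    refine (((h1.sub_const (UB q.2)).pow 2).add (h2.pow 2)).congr_deriv ?_
    norm_num
    ring
  have key := hasDerivAt_integral_of_dominated_loc_of_deriv_le
    (μ := volume.restrict (Ioc 0 L ×ˢ univ)) (x₀ := s)
    (bound := fun q : ℝ × ℝ => 2 * ((3 / 2 + C) * C + C * C) * Real.exp (-k * |q.2|)) hN hFmeas hFint hF'meas
    (Eventually.of_forall fun q σ hσ => hF'le q σ hσ) hwI (Eventually.of_forall hdiff)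
  have e := MeasureTheory.integral_const_mul (μ := volume.restrict (Ioc 0 L ×ˢ univ)) (2:ℝ)
    (fun q : ℝ × ℝ => (u s q.1 q.2 - UB q.2) * deriv (fun r => u r q.1 q.2) s + v s q.1 q.2 * deriv (fun r => v r q.1 q.2) s)
  rw [← e]
  exact key.2

/-- **The gradient budget is continuous in time** (registered sub-goal `energyRelam_continuousOn_gradient`). Under uniform shear tails on `[a′, b′] ⊂ (0, ∞)`,
`σ ↦ ∫∫((∂ₓu)² + (∂_yu − U_B′)² + (∂ₓv)² + (∂_yv)²)` is continuous on `[a′, b′]` (dominated convergence with the bound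
`2C²e^{−k|y|} + 2c_B²e^{−κ|y|}`; the time lines of the slice derivatives are continuous,
`continuousOn_time_dX/dY`). [folklore] -/
theorem energyRelam_continuousOn_gradient : ∀ (ν L a' b' C k : ℝ) (u v p : ℝ → ℝ → ℝ → ℝ), 0 < ν → 0 < a' →
    0 < k → IsStretchedLayerNSSolutionOn (Ioi 0) ν 1 1 L u v p → (∀ s ∈ Icc a' b', SliceTails C k (u s) (v s)) →
      ContinuousOn (fun σ => ∫ q in Ioc 0 L ×ˢ univ, (dX (u σ) q.1 q.2 ^ 2 +
        (dY (u σ) q.1 q.2 - burgersLayerProfileD 1 ν 1 q.2) ^ 2 + dX (v σ) q.1 q.2 ^ 2 + dY (v σ) q.1 q.2 ^ 2))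
        (Icc a' b') := by
  intro ν L a' b' C k u v p hν ha hk h hST
  by_cases hab : a' ≤ b'
  swap
  · rw [Icc_eq_empty hab]; exact continuousOn_empty _
  have hpos : ∀ {σ : ℝ}, σ ∈ Icc a' b' → 0 < σ := fun hσ => ha.trans_le hσ.1
  have hIcc : Icc a' b' ⊆ Ioi 0 := fun σ hσ => hpos hσ
  have hC : 0 ≤ C := (hST a' (left_mem_Icc.2 hab)).nonneg
  obtain ⟨hκ, -, hD0, -, -, cB, hcB1, hcB⟩ := energyRelam_profile hν
  set κ := burgersLayerRate 1 ν with hκ_def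
  set UB' := burgersLayerProfileD 1 ν 1 with hUB'_def
  have cUB' : Continuous (fun q : ℝ × ℝ => UB' q.2) := by
    have hc : Continuous UB' := by rw [hUB'_def]; unfold burgersLayerProfileD; fun_prop
    exact hc.comp continuous_snd
  have hec : ∀ r : ℝ, Continuous (fun q : ℝ × ℝ => Real.exp (-r * |q.2|)) := fun r =>
    Real.continuous_exp.comp (continuous_const.mul (continuous_abs.comp continuous_snd))
  have hw1 : IntegrableOn (fun q : ℝ × ℝ => 2 * C ^ 2 * Real.exp (-k * |q.2|)) (Ioc 0 L ×ˢ univ) :=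
    integrableOn_strip_of_abs_le_exp (continuous_const.mul (hec k)) (by positivity : 0 ≤ 2 * C ^ 2) hk
      fun x _ y => by rw [abs_of_nonneg (by positivity)]
  have hw2 : IntegrableOn (fun q : ℝ × ℝ => 2 * cB ^ 2 * Real.exp (-κ * |q.2|)) (Ioc 0 L ×ˢ univ) :=
    integrableOn_strip_of_abs_le_exp (continuous_const.mul (hec κ)) (by positivity : 0 ≤ 2 * cB ^ 2) hκ
      fun x _ y => by rw [abs_of_nonneg (by positivity)]
  have hwI : IntegrableOn (fun q : ℝ × ℝ => 2 * C ^ 2 * Real.exp (-k * |q.2|) + 2 * cB ^ 2 * Real.exp (-κ * |q.2|))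
      (Ioc 0 L ×ˢ univ) := hw1.add hw2
  refine continuousOn_of_dominated
    (bound := fun q : ℝ × ℝ => 2 * C ^ 2 * Real.exp (-k * |q.2|) + 2 * cB ^ 2 * Real.exp (-κ * |q.2|))
    (fun σ hσ => ?_) (fun σ hσ => Eventually.of_forall fun q => ?_) hwI (Eventually.of_forall fun q => ?_)
  · have h1 : ContDiff ℝ 1 (fun q : ℝ × ℝ => u σ q.1 q.2) := (h.contDiff_u (hIcc hσ)).of_le one_le_two
    have h2 : ContDiff ℝ 1 (fun q : ℝ × ℝ => v σ q.1 q.2) := (h.contDiff_v (hIcc hσ)).of_le one_le_two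
    exact (((((continuous_dX h1).pow 2).add (((continuous_dY h1).sub cUB').pow 2)).add
      ((continuous_dX h2).pow 2)).add ((continuous_dY h2).pow 2)).aestronglyMeasurable
  · rw [Real.norm_eq_abs]
    have hg := (hST σ hσ).abs_gradSq_le hk q.1 q.2
    rw [abs_of_nonneg (by positivity)] at hg
    have hb1 := (hcB q.2).1
    have hb2 := (hcB q.2).2.1
    have hb0 := hD0 q.2
    have hsq : UB' q.2 ^ 2 ≤ cB ^ 2 * Real.exp (-κ * |q.2|) := by
      calc UB' q.2 ^ 2 = UB' q.2 * UB' q.2 := sq _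
        _ ≤ cB * (cB * Real.exp (-κ * |q.2|)) := mul_le_mul hb1 hb2 hb0 (by linarith)
        _ = cB ^ 2 * Real.exp (-κ * |q.2|) := by ring
    rw [abs_of_nonneg (by positivity)]
    nlinarith [sq_nonneg (dY (u σ) q.1 q.2 + UB' q.2), sq_nonneg (dX (u σ) q.1 q.2), sq_nonneg (dX (v σ) q.1 q.2),
      sq_nonneg (dY (v σ) q.1 q.2)]
  · exact (((((continuousOn_time_dX h.contDiffOn_u q.1 q.2).mono hIcc).pow 2).add
      ((((continuousOn_time_dY h.contDiffOn_u q.1 q.2).mono hIcc).sub continuousOn_const).pow 2)).add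
      (((continuousOn_time_dX h.contDiffOn_v q.1 q.2).mono hIcc).pow 2)).add
      (((continuousOn_time_dY h.contDiffOn_v q.1 q.2).mono hIcc).pow 2)

end Summit.AnomalousDissipation.AnomalousDissipation.Theorems.StrainedLayerLaw.LogEnstrophyClock

end
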